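import Summits.BirchSwinnertonDyer.BirchSwinnertonDyer.Theses.InertBadSignedBranches
import Summits.BirchSwinnertonDyer.Rank1Residual.X12.InertBadThreeInstancesBTamagawa
import Summits.BirchSwinnertonDyer.Rank1Residual.X12.CongruentNumberOddPart
import HarnessLib

/-!
# Route `InertBadSignedBranches` (rung K8), D71 child `InertBadAtThreeIstarZero`: a MEMBER of the type
# `(3, I₀*)` and the child's conclusion AT THAT MEMBER — `E₁₅ = 7200bg1` (BC5-style relative witness;
# helper toward stmt-BirchSwinnertonDyer-19656; cell `bsd-cm`, seat `bsd-cm-k8i-c41`; nothing asserted)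

HONEST FRAMING (cell `bsd-cm`, run/shared/lean/pub/bsd-cm/): Birch–Swinnerton-Dyer is NOT proved by
any of this. The item `InertBadAtThreeIstarZero` (for EVERY globally minimal CM curve of signed local
type `(3, I₀*)` and analytic rank one, `Typed.X12.MissingInputAt W 3`) is OPEN at class level and stays
so. This file exhibits ONE member of the type in the kernel and derives the child's conclusion AT THAT
MEMBER from the sibling cell's per-pair record (route T-KR@3) — i.e. inside the per-pair KNOWN regime by
construction (the same honesty as the crux witness `CccOneWitness.cccOneLaw_c16928e1_twentyThree`,
p416644): a relative witness, CONDITIONAL on displayed published facts and two certified data; it does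
not touch the class-level statement. THEOREMS ONLY: 0 definitions, 0 named facts minted, 0 `sorry`.

PARTITION (D-0054): CornerF inert-bad (B12 / O10) × the pair (`7200bg1 = E₁₅`, `3`) ∈ O10-PS@3 (one of
the 57 classes) × `p = 3` — types-the-object-of (membership is UNCONDITIONAL; the conclusion at the
member is the sibling's T-KR@3 closure re-keyed); closes no cell, books nothing, moves no mark.

## What is here

* §1 `hasSignedLocalType_c7200bg1_three` — x1b's record model `7200bg1 = [0, 0, 0, −225, 0]` IS the
  congruent-number curve `E₁₅` (`−225 = −15²`), hence (inert g7's `CongruentNumber.hasSignedLocalType_of_dvd`: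
  `15` squarefree, `3 ∣ 15`, `3 ≡ 3 (mod 4)`) has signed local type `(3, I₀*)`: CM by `ℤ[i]`, `3` INERT
  in `ℚ(i)`, bad at `3`, Kodaira `I₀*` at the place over `3`. UNCONDITIONAL (kernel).
* §2 `missingInputAt_three_c7200bg1` — the child's conclusion `Typed.X12.MissingInputAt 7200bg1 3` GIVEN
  the eight published facts of x1b's record (`hGZ hKo hMN hGZK hmod hnf hFH hCM8`), Cremona's two Manin
  sentences (`h26 h52`), and the certified data `r_an(E₁₅) = 1` (`hr`) and `#Ш(E₁₅)_an = q` with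
  `ord₃ q = 0` (`hq hv`; Cremona `allbsd`: `#Ш_an = 1`) — from the Tamagawa-free record
  `X12.bsdp_three_c7200bg1_tam` (`∏ c_ℓ = 32` in the kernel) by bookkeeping (`Ш` finite by GZK).
* §3 `inertBadAtThreeIstarZero_at_c7200bg1` — both packaged in the item's own shape at the member.

References (locators only): [Cremona1997] Table 1 / `allbsd` (curve 7200bg1: `[0,0,0,−225,0]`, `r = 1`,
`#Ш_an = 1`, `∏ c_ℓ = 32`); [SilvermanATAEC1994] IV.9.4 Step 6, Table 4.1; [Cox2013] §5.B Prop. 5.16,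
Cor. 5.17; [MatarNekovar2019] Thm. 0.3, §0.11; [AgasheRibetStein2006] Thm. 2.6, appendix Thm. 5.2;
[Miller2011LMS] §1, Def. 1.1.
-/

set_option autoImplicit false
set_option linter.dupNamespace false

noncomputable section

open scoped Classical NumberField

open WeierstrassCurve NumberField IsDedekindDomain
open Literature.NumberTheory.EllipticCurves
open Literature.NumberTheory.EllipticCurves.ModularForms
open Literature.NumberTheory.EllipticCurves.Rank1Residual
open Literature.NumberTheory.EllipticCurves.Rank1Residual.Typed
open Literature.NumberTheory.EllipticCurves.AgasheRibetStein2006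
open Summit.BirchSwinnertonDyer.Rank1Residual
open Summit.BirchSwinnertonDyer.Rank1Residual.X12
open Summit.BirchSwinnertonDyer.Rank1Residual.X12.O10

namespace Summit.BirchSwinnertonDyer.BirchSwinnertonDyer.Theorems.InertBadAtThreeWitness

/-! ## §1 The member: `E₁₅ = 7200bg1` has signed local type `(3, I₀*)` — unconditional -/

/-- x1b's record model `7200bg1 = [0, 0, 0, −225, 0]` IS the congruent-number curve `E₁₅`
(`−225 = −15²`). [cite: Cremona1997, Table 1 (curve 7200bg1)] -/
theorem c7200bg1_eq_congruentNumberCurve : Records.c7200bg1 = congruentNumberCurve 15 := by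
  simp only [Records.c7200bg1, congruentNumberCurve]
  norm_num

/-- … hence a model of `E₁₅` in the sense of `X12.CongruentNumber` (identity change of variables).
[cite: Cremona1997, Table 1 (curve 7200bg1)] -/
theorem exists_variableChange_c7200bg1 :
    ∃ C : VariableChange ℚ, C • Records.c7200bg1 = congruentNumberCurve 15 :=
  ⟨1, by rw [one_smul, c7200bg1_eq_congruentNumberCurve]⟩

/-- **`E₁₅ = 7200bg1` has signed local type `(3, I₀*)`** — CM by `ℤ[i]`, `3 ≡ 3 (mod 4)` INERT in
`ℚ(i)`, bad at `3`, Kodaira symbol `I₀*` at the place over `3` (`E₁₅ = E₅^{(−3)}`-type twist,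
`ord₃ 15 = 1`, Tate's algorithm Step 6): a MEMBER of the child's type. UNCONDITIONAL (kernel).
[cite: SilvermanATAEC1994, IV.9.4 Step 6 and Table 4.1] [cite: Cox2013, §5.B Prop. 5.16 and Cor. 5.17] -/
theorem hasSignedLocalType_c7200bg1_three : HasSignedLocalType Records.c7200bg1 3 (.Istar 0) :=
  CongruentNumber.hasSignedLocalType_of_dvd (n := 15)
    (by rw [show (15 : ℕ) = 3 * 5 from rfl, Nat.squarefree_mul (by norm_num)]
        exact ⟨Nat.prime_three.squarefree, Nat.prime_five.squarefree⟩)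
    exists_variableChange_c7200bg1 (by norm_num) (by norm_num) (by norm_num)

/-! ## §2 The child's conclusion AT the member (T-KR@3 form) -/

/-- **The child's conclusion at `(E₁₅, 3)`: `Typed.X12.MissingInputAt 7200bg1 3`** — GIVEN the published
facts of x1b's record (Gross–Zagier `hGZ`, Kolyvagin `hKo`, Matar–Nekovář Thm 0.3 `hMN`, GZK `hGZK`,
modularity `hmod`/`hnf`, Friedberg–Hoffstein `hFH`, the CM rank-zero triple `hCM8`), Cremona's Manin
sentences (`h26`/`h52`), and the certified data `r_an(E₁₅) = 1` (`hr`) and `#Ш(E₁₅)_an = q`, `ord₃ q = 0`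
(`hq`, `hv`; Cremona: `#Ш_an = 1`). Proof: x1b's Tamagawa-free record `bsdp_three_c7200bg1_tam` gives
`BSD(E₁₅, 3)`; `Ш(E₁₅)` is finite by GZK in analytic rank one; bookkeeping (`missingPPartAt_of_bsdp`).
RELATIVE (per-pair known regime); CONDITIONAL on every displayed hypothesis; nothing booked; 19656 stays
OPEN at class level. [cite: Cremona1997, Table 4 (curve 7200bg1: r = 1, #Ш_an = 1)]
[cite: MatarNekovar2019, Thm. 0.3 and §0.11] [cite: AgasheRibetStein2006, Thm. 2.6 and appendix Thm. 5.2]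
[cite: Miller2011LMS, §1 and Def. 1.1] -/
theorem missingInputAt_three_c7200bg1
    (hGZ : ∀ (N : ℕ) [NeZero N] (W : WeierstrassCurve ℚ) (K : Type) [Field K] [NumberField K],
      gross_zagier N W K)
    (hKo : ∀ (N : ℕ) [NeZero N] (W : WeierstrassCurve ℚ) (K : Type) [Field K] [NumberField K],
      kolyvagin N W K)
    (hMN : ∀ (N : ℕ) [NeZero N] (W : WeierstrassCurve ℚ) (K : Type) [Field K] [NumberField K],
      MatarNekovar2019.thm03_padicValNat_card_sha_le_of_irreducible N W K)
    (hGZK : rank_eq_analyticRank_of_analyticRank_le_one) (hmod : hasEntireLFunction_rat)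
    (hnf : exists_isNewformOf) (hFH : friedbergHoffstein_exists_heegnerField_split_twist_ne_zero)
    (hCM8 : bsdTriple_of_hasCM_of_L_one_ne_zero)
    (h26 : cremona_abs_maninConstant_eq_one_of_level_le) (h52 : cremona_optimal_curveOne_x12Three)
    (hr : Records.c7200bg1.analyticRank = 1)
    {q : ℚ} (hq : shaAn Records.c7200bg1 = (q : ℂ)) (hv : padicValRat 3 q = 0) :
    X12.MissingInputAt Records.c7200bg1 3 := by
  intro _
  haveI : Finite Records.c7200bg1.sha := (hGZK Records.c7200bg1 (by rw [hr])).2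
  exact missingPPartAt_of_bsdp Records.c7200bg1 3
    (bsdp_three_c7200bg1_tam hGZ hKo hMN hGZK hmod hnf hFH hCM8 h26 h52 hr hq hv)

/-! ## §3 Packaged in the item's own shape at the member -/

/-- **BC5-style RELATIVE WITNESS for the child `InertBadAtThreeIstarZero` at the member `(E₁₅, 3)`**: the
member IS of signed local type `(3, I₀*)` (unconditional), and — given the published facts of the
sibling's per-pair record, Cremona's Manin sentences and the certified `3`-adic unit `#Ш(E₁₅)_an` — the
item's implication `r_an = 1 → Typed.X12.MissingInputAt E₁₅ 3` holds at it. Regime honesty: the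
conclusion is derived from the per-pair T-KR@3 closure (inside the known regime by construction), not
from the signed-branch chain; the class-level child stays OPEN; nothing booked.
[cite: Cremona1997, Table 4 (curve 7200bg1)] [cite: MatarNekovar2019, Thm. 0.3 and §0.11]
[cite: SilvermanATAEC1994, IV.9.4 and Table 4.1] [cite: Miller2011LMS, §1 and Def. 1.1] -/
theorem inertBadAtThreeIstarZero_at_c7200bg1
    (hGZ : ∀ (N : ℕ) [NeZero N] (W : WeierstrassCurve ℚ) (K : Type) [Field K] [NumberField K],
      gross_zagier N W K)
    (hKo : ∀ (N : ℕ) [NeZero N] (W : WeierstrassCurve ℚ) (K : Type) [Field K] [NumberField K],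
      kolyvagin N W K)
    (hMN : ∀ (N : ℕ) [NeZero N] (W : WeierstrassCurve ℚ) (K : Type) [Field K] [NumberField K],
      MatarNekovar2019.thm03_padicValNat_card_sha_le_of_irreducible N W K)
    (hGZK : rank_eq_analyticRank_of_analyticRank_le_one) (hmod : hasEntireLFunction_rat)
    (hnf : exists_isNewformOf) (hFH : friedbergHoffstein_exists_heegnerField_split_twist_ne_zero)
    (hCM8 : bsdTriple_of_hasCM_of_L_one_ne_zero)
    (h26 : cremona_abs_maninConstant_eq_one_of_level_le) (h52 : cremona_optimal_curveOne_x12Three)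
    {q : ℚ} (hq : shaAn Records.c7200bg1 = (q : ℂ)) (hv : padicValRat 3 q = 0) :
    HasSignedLocalType Records.c7200bg1 3 (.Istar 0) ∧
      (Records.c7200bg1.analyticRank = 1 → X12.MissingInputAt Records.c7200bg1 3) :=
  ⟨hasSignedLocalType_c7200bg1_three,
    fun hr ↦ missingInputAt_three_c7200bg1 hGZ hKo hMN hGZK hmod hnf hFH hCM8 h26 h52 hr hq hv⟩

end Summit.BirchSwinnertonDyer.BirchSwinnertonDyer.Theorems.InertBadAtThreeWitness

end
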